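import Literature.MathematicalPhysics.QuantumFieldTheory.Balaban1983to89.B14Eq349IrrelevantFeed
import Literature.MathematicalPhysics.QuantumFieldTheory.Balaban1983to89.B14Eq348SecondClass

/-!
# `Balaban1983to89.B14.Thm2DisplayChain` — T. Bałaban, *Convergent renormalization expansions for lattice gauge theories*,
# Commun. Math. Phys. **119** (1988) 243–285 [Balaban1988Convergent]: THEOREM 2 ((2.43)–(2.44) p. 263) in the cell's typed
# form `B14.Thm2Printed` ASSEMBLED FROM THE DISPLAY CHAIN (3.48)–(3.67) and the 𝐑-side paragraph of p. 283 AT THE DEEPEST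
# LEVEL WHERE ALL DISPLAYS SHARE ONE CARRIER — per-domain data on ONE abstract system of localization domains and cubes
# (`LocDomainSys` ∕ `CubeSystem`, the (1.26) letters `Δ, c₀, κ` of [II]): the E-side twin of
# `…B14.Ineq244ChartFeed.pointDataR_of_domainBounds`, then both sides into `…B14.Thm2Assembly.thm2Printed_of_pointData`

statement-level skeleton of published theorems with citation tags; proofs where landed; nothing here is a claim about the Yang–Mills mass gap

PDF held: `paper:balaban1988-cmp119-convergent-renormalization` (journal page = PDF page + 242); pp. 263, 279–283 [PDF 21, 37–41].

CITATION HEADER (lean-in-tree rule).  WHAT IS REPRODUCED, verbatim.  [Balaban1988Convergent] Theorem 2 p. 263: *"Under the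
assumptions of Theorem 1 there exists a constant E₁ independent of j, k, Ω, {Ω_j}, {Λ_j}, T (but dependent on the other
constants occurring in the formulation of this theorem), such that |Σ_{z∈Λ_j⁰∩Ω}[𝐄^{(j)}(Λ_j, U_k, z) − 𝐄^{(j)}(Λ_j, 1, z)] −
β_j(g_{j−1})A(φ, U_k)| ≤ E₁Σ_{n=j}^{k}(L^{j−n})^β|Γ_n∩Ω| (2.43) for β < 1 … The constant E₁ depends on β also, and grows to ∞
if β → 1. … there exists an absolute constant R₁ such, that |Σ_{X∈𝐃_j, X⊂Λ_j, X∩Ω≠∅}[𝐑^{(j)}(X, U_k) − 𝐑^{(j)}(X, 1)]| ≤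
R₁g_j^{κ₀}Σ_{n=j}^{k}|Γ_n∩Ω| (2.44)"*; p. 280 (3.48): *"|𝐄^{(j)}(X, U_k, z)| ≤ E₀exp(−κd_j(X)) ≤ E₀exp(−κ(LʲL⁻ⁿ)⁻¹)exp(−½κd_j(X)),
and the sum over X is bounded by O(1)exp(−κ(LʲL⁻ⁿ)⁻¹) ≦ O(1)(LʲL⁻ⁿ)⁵. This is an admissible error contributing only to the
constant on the right-hand side of (2.43)"*; p. 281: *"(the irrelevant terms) above, and in (3.49), denotes the sum of terms
which can be bounded by O((LʲL⁻ⁿ)^{5−β}) exp(−κd_j(X)), where β is a positive number"*; p. 283: *"β′_j(g_{j−1}, g_j) =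
β_j(g_{j−1}) (3.64) … A(h_z, U_k) = ½Σ_{μ<ν} tr F²_{μν}(z) + (the irrelevant terms) (3.66) … 𝐄^{(j)}(Λ_j, U_k, z) − 𝐄^{(j)}(Λ_j,
1, z) − β_jA(h_z, U_k) = O((LʲL⁻ⁿ)^{5−β}), (3.67) for z ∈ Λ_j⁰∩(Ω_n∖Ω_{n+1}), β > 0. Summing over z ∈ Λ_j⁰∩Ω w get the inequality
(2.43) … The inequality (2.44) for the functions 𝐑^{(j)} can be proved in an almost identical way. … Now all the terms on the
right-hand side can be bounded by O(1)(LʲL⁻ⁿ)⁴g_j^{κ₀} exp(−κd_j(X)), and this yields the inequality (2.44). The proof of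
Theorem 2 is completed."*  [Balaban1988RG2Cluster] (1.26) p. 8: *"Σ_{X∈𝐃_j, X⊃□′} exp(−κd_j(X)) ≤ O(1)"*.

SKELETON rows (owner r11): **B14.Thm2** (`B14.Thm2Printed` :270, typed-existing), **B14.Eq3.48**, **B14.Eq3.49**, **B14.Eq3.64**,
**B14.Eq3.66**, **B14.Eq3.67**, **B14.Claim@283R**; proof-side modules cited BY NAME, unchanged: `…B14.Thm2Assembly` (§3
`thm2Printed_of_pointData`: Theorem 2 from NUMBER-level per-point data `PointDataE`∕`PointDataR`), `…B14.Eq367Assembly`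
((3.61)+(3.64)+(3.66)+(3.48) ⇒ (3.67) ⇒ (2.43), numbers), `…B14.Eq349IrrelevantFeed` (§3 `perPointIrrelevant_printedShape`:
per-domain irrelevant terms of (3.49) ⇒ the per-point `|I₁ z| ≤ c₁(L^{j−n})^{5−b}` by (1.26)), `…B14.Eq348SecondClass`
(`abs_secondClass_sum_le`: (3.48) ⇒ per-point second-class sum `≤ c₃(L^{j−n})^{5−b}` by (1.26) at `κ/2`), `…B14.Ineq244ChartFeed`
(§1 `pointDataR_of_domainBounds`: p. 283's per-domain 𝐑-bounds ⇒ `PointDataR` — the 𝐑-side twin of this file's §2, LANDED).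

WHY THIS FILE (pub-ymgap director-ym R134, node N11, strategy s1: «ASSEMBLE `B14.Thm2Printed` from the display chain
(3.48)–(3.65), (3.67), p. 283 𝐑-side»).  In the tree the E-side of Theorem 2 is assembled only at NUMBER level — `PointDataE`
takes, per point `z`, real numbers `F, G, A, Q, I₁, I₂, β_j, β′_j` with the three irrelevant bounds as hypotheses — while
every display feed one level down ((3.48) second class, (3.49) irrelevant terms, the 𝐑-side per-domain bound) is typed
over the SHARED abstract carrier of localization domains and cubes with the (1.26) letters.  The 𝐑-side has its
domain-level assembler (`pointDataR_of_domainBounds`); the E-side twin was missing.  Below the domain level the feeds'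
carriers DIVERGE (lattice windows of `…B14.LettersScaleN*` for the (3.49)∕(3.66) letters, chart functionals of
`…_of_charts`, torus classes of `…B14Eq348TorusClasses`) and meet only in Bałaban's concrete 𝐄^{(j)}(X, U_k, z) — the
ONE-CARRIER INSTANTIATION (row B14.Thm2 head policy G.5-45; pub-ymgap NODE 00), not attempted here.

WHAT THIS FILE PROVES (theorems only; 0 `def`, 0 `sorry`).  §1 `secondClass_sum_le_of_subfamily` — (3.48) summed over an
ASSIGNED finite sub-family `A₂ ⊆ {X ⊃ □_z}` of second-class domains (terms extended by zero; `abs_secondClass_sum_le`).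
§2 **`pointDataE_of_domainBounds`** — ONE RUN: if every `(j, k, Ω)` is represented on one cube system (degree `≤ Δ`, volume
leaf `c₀`, `κ₀(c₀, Δ) ≤ κ/2`, `κ > 0`) by points `z` of scales `n_z ∈ [j, k]` with cubes `□_z`, first-class families `A₁ z`
carrying per-domain irrelevant terms `|i(z, X)| ≤ C₁σ_z⁴σ_z^{1−b}exp(−κd_j(X))` (p. 281; `σ_z = L^{j−n_z}`), second-class
families `A₂ z` with the class geometry `d_j(X) ≥ 2σ_z⁻¹` and `|e(z, X)| ≤ C₂exp(−κd_j(X))` ((3.48), (I.1.18) for the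
difference), numbers `Q z` ((3.66)'s `½Σtr F²(z)`), `I₂ z` with `|I₂ z| ≤ c₂σ_z^{5−b}` ((3.66)), `β_j` with `|β_j| ≤ β̄` and
`β′_j = β_j` ((3.64)), the identity `eTerm j k Ω = Σ_z((β′Q(z) + Σ_{A₁ z}i) + Σ_{A₂ z}e − β_j(Q(z) + I₂ z))` ((2.27) + (3.61)
+ (3.66)) and the p. 263 point count — then `PointDataE S L (C₁K₀) c₂ (C₂K₀(5/κ)⁵e⁻⁵) β̄ b`, constants EXPLICIT.
§3 `thm2Printed_of_pointData_at` (the single-exponent sharpening of `thm2Printed_of_pointData`: number-level data at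
`b = 1 − β` only ⇒ `Thm2Printed … β`; print proves (2.43) *"with 1 − β, β > 0, instead of β < 1"* for ONE β);
**`thm2Printed_of_domainBounds_at`** (FAMILY of runs, single exponent: E-side domain data at `b = 1 − β` + 𝐑-side domain data
with uniform letters ⇒ `B14.Thm2Printed H033 fam L β κ₀`, `E₁ = C₁K₀ + β̄c₂ + C₂K₀(5/κ)⁵e⁻⁵`, `R₁ = CK₀`) and
**`thm2Printed_of_domainBounds`** (the «∀ b > 0» form matching *"E₁ depends on β also"*: data for every `b > 0` ⇒ `Thm2Printed`
for every β).  NOT HERE: that Bałaban's functions supply these data ([III] §3 with [I] §§4–5 on his configuration spaces).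

HONEST FRAMING.  Count-neutral KERNEL GLUE over landed modules (pub-ymgap Track A, HUMAN RULING D-0062, seat
`pub-ymgap-dag-n11-c`, `--supports` K1 `StabilityBAtRecordR11e` = stmt-QuantumFields-19674); node N11 NOT discharged;
nothing of Bałaban's asserted — the per-domain displays are HYPOTHESES on the run's bookkeeping exactly as in `B14Sect3.Rep367`∕
`Rep244`, their object-level dischargers being `…Eq349IrrelevantFeed.irrelevant349_le_printedShape`,
`…Eq356ExtensionFeed.mainTerm_le_of_chart`, `…Ineq244ChartFeed.domainTerm_le_of_chart`, `…Eq366Irrelevant.irrelevant366_printedShape`,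
`…Eq364Beta.eq364` (each on its own carrier).  «`Thm2Printed` AT NODE 00's RECORD» is NOT statable by name today (the
𝐄-terms of record are existential inside `Node00.HasSect2FormAE`; no `TermTowerOfRecord` constant).  One finite four-torus
programme at fixed ε; NOT ℝ⁴, NOT infinite volume, NOT OS, NOT a mass gap, NOT Clay.

## References
* [Balaban1988Convergent] T. Bałaban, Commun. Math. Phys. 119 (1988) 243–285: Thm 2 (2.43)–(2.44) p.263, (3.48) p.280, p.281,
  (3.61) p.282, (3.64)–(3.67) p.283.
* [Balaban1988RG2Cluster] T. Bałaban, Commun. Math. Phys. 116 (1988) 1–22 ([II]: (1.26) p.8).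
* [Balaban1987RG1] T. Bałaban, Commun. Math. Phys. 109 (1987) 249–301 ([I]: (1.18) p.263).
-/

open scoped BigOperators

namespace Literature.MathematicalPhysics.QuantumFieldTheory.Balaban1983to89.B14.Thm2DisplayChain

open Finset
open Literature.MathematicalPhysics.QuantumFieldTheory.Balaban1983to89
open Literature.MathematicalPhysics.QuantumFieldTheory.Balaban1983to89.B12TreeDecay
open Literature.MathematicalPhysics.QuantumFieldTheory.Balaban1983to89.B14.Thm2Assembly (PointDataE PointDataR
  thm2_conjuncts_of_pointData thm2Printed_of_pointData)

/-! ## §1. (3.48) over an assigned sub-family of second-class domains -/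

section SecondClass

variable {Sy : LocDomainSys} (G : CubeSystem Sy)

/-- **(3.48) summed over the second-class domains ASSIGNED to the point `z`** (p. 280: *"the sum over X is bounded by
O(1)exp(−κ(LʲL⁻ⁿ)⁻¹) ≦ O(1)(LʲL⁻ⁿ)⁵ … an admissible error"*): for a finite family `A₂ ⊆ {X ⊃ □_z}` of domains with the
second-class geometry `d_j(X) ≥ 2s⁻¹` (`s = LʲL⁻ⁿ ∈ (0, 1]`) and terms `|e(X)| ≤ C·exp(−κd_j(X))` ((I.1.18) for the difference
`𝐄^{(j)}(X, U_k, z) − 𝐄^{(j)}(X, 1, z)`), `|Σ_{X∈A₂} e(X)| ≤ C·K₀(c₀, Δ)·(5/κ)⁵e⁻⁵·s^{5−b}` for every `b ≥ 0` whenever `κ₀(c₀, Δ) ≤ κ/2`,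
`κ > 0` — `…Eq348SecondClass.abs_secondClass_sum_le` on the terms extended by zero. [cite: Balaban1988Convergent, (3.48) p.280;
Balaban1988RG2Cluster, (1.26) p.8] -/
theorem secondClass_sum_le_of_subfamily {Δ : ℕ} (hΔ : G.DegreeLE Δ) {c₀ : ℝ} (hV : G.VolumeLeaf c₀) {κ : ℝ}
    (hκ : kappa₀ c₀ Δ ≤ κ / 2) (hκ0 : 0 < κ) {A₂ : Finset Sy.Dom} {cz : G.Cube} (hA : A₂ ⊆ G.above cz)
    {e : Sy.Dom → ℝ} {C s b : ℝ} (hC : 0 ≤ C) (hs : 0 < s) (hs1 : s ≤ 1) (hb : 0 ≤ b)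
    (hclass : ∀ X ∈ A₂, 2 * s⁻¹ ≤ Sy.dj X) (he : ∀ X ∈ A₂, |e X| ≤ C * Real.exp (-κ * Sy.dj X)) :
    |∑ X ∈ A₂, e X| ≤ C * K₀ c₀ Δ * (((5 : ℝ) / κ) ^ 5 * Real.exp (-(5 : ℝ))) * s ^ ((5 : ℝ) - b) := by
  classical
  set e' : Sy.Dom → ℝ := fun X => if X ∈ A₂ then e X else 0 with he'_def
  have h118 : ∀ X, |e' X| ≤ C * Real.exp (-κ * Sy.dj X) := by
    intro X
    by_cases hX : X ∈ A₂
    · have eq : e' X = e X := by simp [he'_def, hX]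
      rw [eq]
      exact he X hX
    · have eq : e' X = 0 := by simp [he'_def, hX]
      rw [eq, abs_zero]
      positivity
  have key := Eq348SecondClass.abs_secondClass_sum_le G hΔ hV hC hκ hκ0 hs hs1 hb h118 cz (fun X => X ∈ A₂)
    (fun X _ hXA => hclass X hXA)
  have hfilter : (G.above cz).filter (fun X => X ∈ A₂) = A₂ := by
    ext X
    simp only [Finset.mem_filter]
    exact ⟨fun h => h.2, fun h => ⟨hA h, h⟩⟩
  have hsum : ∑ X ∈ (G.above cz).filter (fun X => X ∈ A₂), e' X = ∑ X ∈ A₂, e X := by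
    rw [hfilter]
    exact Finset.sum_congr rfl fun X hX => by simp [he'_def, hX]
  rw [hsum] at key
  exact key

end SecondClass

/-! ## §2. `PointDataE` for ONE RUN from per-domain display data on one cube system -/

/-- The scale `σ = L^{j−n}` of a point of scale `n ≥ j` is in `(0, 1]` for `L ≥ 1`. [folklore] -/
private theorem sigma_pos_le_one {L : ℝ} (hL : 1 ≤ L) {j n : ℕ} (hjn : j ≤ n) :
    0 < L ^ ((j : ℝ) - n) ∧ L ^ ((j : ℝ) - n) ≤ 1 := by
  refine ⟨Real.rpow_pos_of_pos (lt_of_lt_of_le one_pos hL) _, Real.rpow_le_one_of_one_le_of_nonpos hL ?_⟩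
  have : (j : ℝ) ≤ n := by exact_mod_cast hjn
  linarith

/-- **The E-side per-point data `PointDataE` of ONE RUN from PER-DOMAIN display data** (pp. 279–283 on ONE system of
localization domains and cubes with the (1.26) letters): for every triple `(j, k, Ω)` of the run `S` — points `z ∈ Z`
(naturals, as in `B14Sect3.Rep367`) of scales `n_z = sc z ∈ [j, k]` with cubes `□_z = cz z`; FIRST-CLASS families `A₁ z ⊆
{X ⊃ □_z}` whose domains carry the (3.49) irrelevant terms `i(z, X)` with p. 281's *"O((LʲL⁻ⁿ)^{5−β})exp(−κd_j(X))"* bound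
`|i(z, X)| ≤ C₁σ_z⁴σ_z^{1−b}exp(−κd_j(X))`, `σ_z = L^{j−n_z}`; SECOND-CLASS families `A₂ z ⊆ {X ⊃ □_z}` with the class geometry
`d_j(X) ≥ 2σ_z⁻¹` and `|e(z, X)| ≤ C₂exp(−κd_j(X))` ((3.48)); the numbers `Q z = ½Σ_{μ<ν}tr F²_{μν}(z)`, the (3.66) relocation
term `|I₂ z| ≤ c₂σ_z^{5−b}`, the coupling value `β_j` with `|β_j| ≤ β̄` and (3.64) `β′_j = β_j`; the identity `S.eTerm j k Ω =
Σ_z((β′_jQ(z) + Σ_{X∈A₁ z}i(z, X)) + Σ_{X∈A₂ z}e(z, X) − β_j(Q(z) + I₂ z))` ((2.27) first∕second class at `z`, (3.61), (3.66));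
and the p. 263 point count `#{z : n_z = n} ≤ (L^{n−j})⁴|Γ_n∩Ω|` — then `PointDataE S L (C₁K₀(c₀,Δ)) c₂ (C₂K₀(c₀,Δ)(5/κ)⁵e⁻⁵) β̄ b`:
`…Eq349IrrelevantFeed.perPointIrrelevant_printedShape` on `A₁ z`, `secondClass_sum_le_of_subfamily` on `A₂ z`.
[cite: Balaban1988Convergent, (3.67) p.283, (3.48) p.280, p.281, (3.61) p.282, (3.64) p.283, (3.66) p.283, (2.27) p.259;
Balaban1988RG2Cluster, (1.26) p.8] -/
theorem pointDataE_of_domainBounds (S : B14.Sect2Data) {Δ : ℕ} {c₀ κ C₁ C₂ c₂ βbar L b : ℝ}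
    (hC₁ : 0 ≤ C₁) (hC₂ : 0 ≤ C₂) (hκ0 : 0 < κ) (hL : 1 ≤ L) (hb : 0 ≤ b)
    (h : ∀ j k ω, 1 ≤ j → j ≤ k → k ≤ S.K →
      ∃ (Sy : LocDomainSys) (G : CubeSystem Sy) (_ : G.DegreeLE Δ) (_ : G.VolumeLeaf c₀) (_ : kappa₀ c₀ Δ ≤ κ / 2)
        (Z : Finset ℕ) (sc : ℕ → ℕ) (cz : ℕ → G.Cube) (A₁ A₂ : ℕ → Finset Sy.Dom) (i e : ℕ → Sy.Dom → ℝ)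
        (Q I₂ βj β' : ℕ → ℝ),
        S.eTerm j k ω =
            ∑ z ∈ Z, (((β' z * Q z + ∑ X ∈ A₁ z, i z X) + ∑ X ∈ A₂ z, e z X) - βj z * (Q z + I₂ z)) ∧
        (∀ z ∈ Z, j ≤ sc z ∧ sc z ≤ k) ∧
        (∀ z ∈ Z, A₁ z ⊆ G.above (cz z) ∧ A₂ z ⊆ G.above (cz z)) ∧
        (∀ z ∈ Z, ∀ X ∈ A₁ z,
          |i z X| ≤ C₁ * (L ^ ((j : ℝ) - sc z)) ^ 4 * (L ^ ((j : ℝ) - sc z)) ^ (1 - b) * Real.exp (-κ * Sy.dj X)) ∧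
        (∀ z ∈ Z, ∀ X ∈ A₂ z, 2 * (L ^ ((j : ℝ) - sc z))⁻¹ ≤ Sy.dj X ∧ |e z X| ≤ C₂ * Real.exp (-κ * Sy.dj X)) ∧
        (∀ z ∈ Z, β' z = βj z ∧ |βj z| ≤ βbar ∧ |I₂ z| ≤ c₂ * (L ^ ((j : ℝ) - sc z)) ^ ((5 : ℝ) - b)) ∧
        (∀ n, ((Z.filter (fun z => sc z = n)).card : ℝ) ≤ (L ^ ((n : ℝ) - j)) ^ (4 : ℝ) * S.gammaVol n ω)) :
    PointDataE S L (C₁ * K₀ c₀ Δ) c₂ (C₂ * K₀ c₀ Δ * (((5 : ℝ) / κ) ^ 5 * Real.exp (-(5 : ℝ)))) βbar b := by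
  intro j k ω hj hjk hkK
  obtain ⟨Sy, G, hΔ, hV, hκ, Z, sc, cz, A₁, A₂, i, e, Q, I₂, βj, β', hsum, hsc, hA, hi, he, hnum, hcount⟩ :=
    h j k ω hj hjk hkK
  have hκ' : kappa₀ c₀ Δ ≤ κ := hκ.trans (by linarith)
  refine ⟨Z, sc, fun z => β' z * Q z + ∑ X ∈ A₁ z, i z X, fun z => ∑ X ∈ A₂ z, e z X, fun z => Q z + I₂ z, Q,
    fun z => ∑ X ∈ A₁ z, i z X, I₂, βj, β', hsum, hsc, fun z hz => ?_, hcount⟩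
  obtain ⟨hσpos, hσ1⟩ := sigma_pos_le_one hL (hsc z hz).1
  refine ⟨rfl, rfl, (hnum z hz).1, (hnum z hz).2.1, ?_, (hnum z hz).2.2, ?_⟩
  · exact Eq349IrrelevantFeed.perPointIrrelevant_printedShape G hΔ hV hκ' (hA z hz).1 hC₁ hL (hsc z hz).1 (hi z hz)
  · exact secondClass_sum_le_of_subfamily G hΔ hV hκ hκ0 (hA z hz).2 hC₂ hσpos hσ1 hb (fun X hX => (he z hz X hX).1)
      (fun X hX => (he z hz X hX).2)

/-! ## §3. Theorem 2 (`B14.Thm2Printed`) for a FAMILY of runs from per-domain display data -/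

/-- **Theorem 2 from NUMBER-level per-point data at ONE exponent** (sharpening of `…Thm2Assembly.thm2Printed_of_pointData`,
which asks the E-side data for every `b > 0`): `PointDataE` at `b = 1 − β` and `PointDataR`, with constants uniform over the
family, give `B14.Thm2Printed H033 fam L β κ₀` — print proves (2.43) *"with 1 − β, β > 0, instead of β < 1"* for the one
Hölder exponent at hand; `E₁ = c₁ + β̄c₂ + c₃`, `R₁ = c′`.  The hypothesis parameter `H033` and `SatisfiesRG` are not used by
this summation step. [cite: Balaban1988Convergent, Thm 2 (2.43)–(2.44) p.263, (3.67) p.283] -/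
theorem thm2Printed_of_pointData_at (H033 : Flow → ℕ → Prop) {I : Type} (fam : I → B14.Sect2Data) (L β : ℝ) (κ₀ : ℕ)
    (hL : 0 < L) (hg : ∀ i j, 0 ≤ (fam i).flow.g j) {c₁ c₂ c₃ βbar c' : ℝ} (hc₁ : 0 ≤ c₁) (hc₂ : 0 ≤ c₂) (hc₃ : 0 ≤ c₃)
    (hβbar : 0 ≤ βbar) (hc' : 0 ≤ c') (hE : ∀ i, PointDataE (fam i) L c₁ c₂ c₃ βbar (1 - β))
    (hR : ∀ i, PointDataR (fam i) L c' κ₀) :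
    B14.Thm2Printed H033 fam L β κ₀ := by
  intro _
  refine ⟨c₁ + βbar * c₂ + c₃, c', fun i _ _ => ?_⟩
  have h := thm2_conjuncts_of_pointData (fam i) hL hc₁ hc₂ hc₃ hβbar hc' (hg i) (hE i) (hR i)
  exact ⟨h.1, h.2⟩

/-- **THEOREM 2 FOR A FAMILY OF RUNS FROM PER-DOMAIN DISPLAY DATA, ONE EXPONENT** (the printed uniformity *"E₁ independent
of j, k, Ω, {Ω_j}, {Λ_j}, T"*, *"absolute constant R₁"*): if every run of the family carries, with the SAME letters `Δ, c₀, κ,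
C₁, C₂, c₂, β̄` and exponent `b = 1 − β`, the E-side per-domain data of `pointDataE_of_domainBounds` ((3.48)∕(3.49)→(3.65)∕
(3.64)∕(3.66)∕(2.27)+(3.61) identity∕p. 263 count), and, with the SAME letters `Δ′, c₀′, κ′, C`, the 𝐑-side per-domain data of
`…Ineq244ChartFeed.pointDataR_of_domainBounds` (p. 283: *"all the terms … bounded by O(1)(LʲL⁻ⁿ)⁴g_j^{κ₀}exp(−κd_j(X))"*), and
the couplings are nonnegative, then `B14.Thm2Printed H033 fam L β κ₀` with `E₁ = C₁K₀(c₀,Δ) + β̄c₂ + C₂K₀(c₀,Δ)(5/κ)⁵e⁻⁵`,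
`R₁ = CK₀(c₀′,Δ′)`. [cite: Balaban1988Convergent, Thm 2 (2.43)–(2.44) p.263, (3.48) p.280, p.281, (3.64)–(3.67) p.283;
Balaban1988RG2Cluster, (1.26) p.8] -/
theorem thm2Printed_of_domainBounds_at (H033 : Flow → ℕ → Prop) {I : Type} (fam : I → B14.Sect2Data) (L β : ℝ)
    (κ₀ : ℕ) (hL : 1 ≤ L) (hβ : β ≤ 1) (hg : ∀ i j, 0 ≤ (fam i).flow.g j)
    {Δ : ℕ} {c₀ κ C₁ C₂ c₂ βbar : ℝ} (hκ0 : 0 < κ) (hC₁ : 0 ≤ C₁) (hC₂ : 0 ≤ C₂) (hc₂ : 0 ≤ c₂) (hβbar : 0 ≤ βbar)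
    (hE : ∀ i', ∀ j k ω, 1 ≤ j → j ≤ k → k ≤ (fam i').K →
      ∃ (Sy : LocDomainSys) (G : CubeSystem Sy) (_ : G.DegreeLE Δ) (_ : G.VolumeLeaf c₀) (_ : kappa₀ c₀ Δ ≤ κ / 2)
        (Z : Finset ℕ) (sc : ℕ → ℕ) (cz : ℕ → G.Cube) (A₁ A₂ : ℕ → Finset Sy.Dom) (i e : ℕ → Sy.Dom → ℝ)
        (Q I₂ βj β' : ℕ → ℝ),
        (fam i').eTerm j k ω =
            ∑ z ∈ Z, (((β' z * Q z + ∑ X ∈ A₁ z, i z X) + ∑ X ∈ A₂ z, e z X) - βj z * (Q z + I₂ z)) ∧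
        (∀ z ∈ Z, j ≤ sc z ∧ sc z ≤ k) ∧
        (∀ z ∈ Z, A₁ z ⊆ G.above (cz z) ∧ A₂ z ⊆ G.above (cz z)) ∧
        (∀ z ∈ Z, ∀ X ∈ A₁ z,
          |i z X| ≤ C₁ * (L ^ ((j : ℝ) - sc z)) ^ 4 * (L ^ ((j : ℝ) - sc z)) ^ (1 - (1 - β)) *
            Real.exp (-κ * Sy.dj X)) ∧
        (∀ z ∈ Z, ∀ X ∈ A₂ z, 2 * (L ^ ((j : ℝ) - sc z))⁻¹ ≤ Sy.dj X ∧ |e z X| ≤ C₂ * Real.exp (-κ * Sy.dj X)) ∧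
        (∀ z ∈ Z, β' z = βj z ∧ |βj z| ≤ βbar ∧ |I₂ z| ≤ c₂ * (L ^ ((j : ℝ) - sc z)) ^ ((5 : ℝ) - (1 - β))) ∧
        (∀ n, ((Z.filter (fun z => sc z = n)).card : ℝ) ≤ (L ^ ((n : ℝ) - j)) ^ (4 : ℝ) * (fam i').gammaVol n ω))
    {Δ' : ℕ} {c₀' κ' C : ℝ} (hC : 0 ≤ C)
    (hR : ∀ i', ∀ j k ω, 1 ≤ j → j ≤ k → k ≤ (fam i').K →
      ∃ (Sy : LocDomainSys) (G : CubeSystem Sy) (_ : G.DegreeLE Δ') (_ : G.VolumeLeaf c₀') (_ : kappa₀ c₀' Δ' ≤ κ')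
        (Z : Finset ℕ) (sc : ℕ → ℕ) (cz : ℕ → G.Cube) (A : ℕ → Finset Sy.Dom) (r : ℕ → Sy.Dom → ℝ),
        (fam i').rTerm j k ω = ∑ z ∈ Z, ∑ X ∈ A z, r z X ∧ (∀ z ∈ Z, j ≤ sc z ∧ sc z ≤ k) ∧
        (∀ z ∈ Z, A z ⊆ G.above (cz z)) ∧
        (∀ z ∈ Z, ∀ X ∈ A z,
          |r z X| ≤ C * (L ^ ((j : ℝ) - sc z)) ^ 4 * ((fam i').flow.g j) ^ κ₀ * Real.exp (-κ' * Sy.dj X)) ∧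
        (∀ n, ((Z.filter (fun z => sc z = n)).card : ℝ) ≤ (L ^ ((n : ℝ) - j)) ^ (4 : ℝ) * (fam i').gammaVol n ω)) :
    B14.Thm2Printed H033 fam L β κ₀ :=
  have hL0 : 0 < L := lt_of_lt_of_le one_pos hL
  thm2Printed_of_pointData_at H033 fam L β κ₀ hL0 hg (mul_nonneg hC₁ (K₀_pos c₀ Δ).le) hc₂
    (mul_nonneg (mul_nonneg hC₂ (K₀_pos c₀ Δ).le)
      (mul_nonneg (pow_nonneg (div_nonneg (by norm_num) hκ0.le) 5) (Real.exp_nonneg _)))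
    hβbar (mul_nonneg hC (K₀_pos c₀' Δ').le)
    (fun i' => pointDataE_of_domainBounds (fam i') hC₁ hC₂ hκ0 hL (by linarith) (hE i'))
    (fun i' => Ineq244ChartFeed.pointDataR_of_domainBounds (fam i') hC hL0 (hg i') (hR i'))

/-- **THEOREM 2 FOR A FAMILY OF RUNS FROM PER-DOMAIN DISPLAY DATA, «E₁ DEPENDS ON β»** (the form consumed by
`…Thm2Assembly.thm2Printed_of_pointData`): if for EVERY `b > 0` there are letters `Δ, c₀, κ > 0, C₁, C₂, c₂, β̄ ≥ 0`, uniform over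
the family, with the E-side per-domain data of `pointDataE_of_domainBounds` at exponent `b` for every run (*"The constant E₁
depends on β also, and grows to ∞ if β → 1"*), and letters `Δ′, c₀′, κ′, C ≥ 0` with the 𝐑-side per-domain data of
`…Ineq244ChartFeed.pointDataR_of_domainBounds` for every run, and the couplings are nonnegative, then `B14.Thm2Printed H033 fam L β
κ₀` for every `β` (the typed statement carries its own guard `β < 1`). [cite: Balaban1988Convergent, Thm 2 (2.43)–(2.44) p.263,
(3.48) p.280, p.281, (3.64)–(3.67) p.283; Balaban1988RG2Cluster, (1.26) p.8] -/
theorem thm2Printed_of_domainBounds (H033 : Flow → ℕ → Prop) {I : Type} (fam : I → B14.Sect2Data) (L β : ℝ) (κ₀ : ℕ)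
    (hL : 1 ≤ L) (hg : ∀ i j, 0 ≤ (fam i).flow.g j)
    (hE : ∀ b : ℝ, 0 < b → ∃ (Δ : ℕ) (c₀ κ C₁ C₂ c₂ βbar : ℝ), 0 < κ ∧ 0 ≤ C₁ ∧ 0 ≤ C₂ ∧ 0 ≤ c₂ ∧ 0 ≤ βbar ∧
      ∀ i', ∀ j k ω, 1 ≤ j → j ≤ k → k ≤ (fam i').K →
        ∃ (Sy : LocDomainSys) (G : CubeSystem Sy) (_ : G.DegreeLE Δ) (_ : G.VolumeLeaf c₀) (_ : kappa₀ c₀ Δ ≤ κ / 2)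
          (Z : Finset ℕ) (sc : ℕ → ℕ) (cz : ℕ → G.Cube) (A₁ A₂ : ℕ → Finset Sy.Dom) (i e : ℕ → Sy.Dom → ℝ)
          (Q I₂ βj β' : ℕ → ℝ),
          (fam i').eTerm j k ω =
              ∑ z ∈ Z, (((β' z * Q z + ∑ X ∈ A₁ z, i z X) + ∑ X ∈ A₂ z, e z X) - βj z * (Q z + I₂ z)) ∧
          (∀ z ∈ Z, j ≤ sc z ∧ sc z ≤ k) ∧
          (∀ z ∈ Z, A₁ z ⊆ G.above (cz z) ∧ A₂ z ⊆ G.above (cz z)) ∧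
          (∀ z ∈ Z, ∀ X ∈ A₁ z,
            |i z X| ≤ C₁ * (L ^ ((j : ℝ) - sc z)) ^ 4 * (L ^ ((j : ℝ) - sc z)) ^ (1 - b) * Real.exp (-κ * Sy.dj X)) ∧
          (∀ z ∈ Z, ∀ X ∈ A₂ z, 2 * (L ^ ((j : ℝ) - sc z))⁻¹ ≤ Sy.dj X ∧ |e z X| ≤ C₂ * Real.exp (-κ * Sy.dj X)) ∧
          (∀ z ∈ Z, β' z = βj z ∧ |βj z| ≤ βbar ∧ |I₂ z| ≤ c₂ * (L ^ ((j : ℝ) - sc z)) ^ ((5 : ℝ) - b)) ∧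
          (∀ n, ((Z.filter (fun z => sc z = n)).card : ℝ) ≤ (L ^ ((n : ℝ) - j)) ^ (4 : ℝ) * (fam i').gammaVol n ω))
    (hR : ∃ (Δ' : ℕ) (c₀' κ' C : ℝ), 0 ≤ C ∧ ∀ i', ∀ j k ω, 1 ≤ j → j ≤ k → k ≤ (fam i').K →
      ∃ (Sy : LocDomainSys) (G : CubeSystem Sy) (_ : G.DegreeLE Δ') (_ : G.VolumeLeaf c₀') (_ : kappa₀ c₀' Δ' ≤ κ')
        (Z : Finset ℕ) (sc : ℕ → ℕ) (cz : ℕ → G.Cube) (A : ℕ → Finset Sy.Dom) (r : ℕ → Sy.Dom → ℝ),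
        (fam i').rTerm j k ω = ∑ z ∈ Z, ∑ X ∈ A z, r z X ∧ (∀ z ∈ Z, j ≤ sc z ∧ sc z ≤ k) ∧
        (∀ z ∈ Z, A z ⊆ G.above (cz z)) ∧
        (∀ z ∈ Z, ∀ X ∈ A z,
          |r z X| ≤ C * (L ^ ((j : ℝ) - sc z)) ^ 4 * ((fam i').flow.g j) ^ κ₀ * Real.exp (-κ' * Sy.dj X)) ∧
        (∀ n, ((Z.filter (fun z => sc z = n)).card : ℝ) ≤ (L ^ ((n : ℝ) - j)) ^ (4 : ℝ) * (fam i').gammaVol n ω)) :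
    B14.Thm2Printed H033 fam L β κ₀ := by
  have hL0 : 0 < L := lt_of_lt_of_le one_pos hL
  refine thm2Printed_of_pointData H033 fam L β κ₀ hL0 hg (fun b hb => ?_) ?_
  · obtain ⟨Δ, c₀, κ, C₁, C₂, c₂, βbar, hκ0, hC₁, hC₂, hc₂, hβbar, hdata⟩ := hE b hb
    exact ⟨C₁ * K₀ c₀ Δ, c₂, C₂ * K₀ c₀ Δ * (((5 : ℝ) / κ) ^ 5 * Real.exp (-(5 : ℝ))), βbar,
      mul_nonneg hC₁ (K₀_pos c₀ Δ).le, hc₂,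
      mul_nonneg (mul_nonneg hC₂ (K₀_pos c₀ Δ).le)
        (mul_nonneg (pow_nonneg (div_nonneg (by norm_num) hκ0.le) 5) (Real.exp_nonneg _)),
      hβbar, fun i' => pointDataE_of_domainBounds (fam i') hC₁ hC₂ hκ0 hL hb.le (hdata i')⟩
  · obtain ⟨Δ', c₀', κ', C, hC, hdata⟩ := hR
    exact ⟨C * K₀ c₀' Δ', mul_nonneg hC (K₀_pos c₀' Δ').le, fun i' =>
      Ineq244ChartFeed.pointDataR_of_domainBounds (fam i') hC hL0 (hg i') (hdata i')⟩

end Literature.MathematicalPhysics.QuantumFieldTheory.Balaban1983to89.B14.Thm2DisplayChain
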